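import Summits.BirchSwinnertonDyer.Rank1Residual.GaloisImage.TateModuleEulerFactor
import HarnessLib

/-!
# Rubin's Euler factor of `T_p E` EVALUATED AT THE OPERATOR `Fr_q⁻¹` on the Tate module:
# `P(Fr⁻¹ | T*; Fr⁻¹) = N_q · Z_q` exactly (cell `b2b-bsdres`, team n1011; K4 = ROW T-DER-CK item (g),
# the sequel of K1 `TateModuleEulerFactor`: input (6) of THEOREM C's assembly C0d/C3 named by
# n1011-p11 GEN 8; seat p13, the other items of T-DER-CK being n1011-p15's)

HONEST FRAMING (cell `b2b-bsdres`, run/shared/lean/b2b/bsd-rank1-residual/, verbatim in every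
file): the goal of the cell is to DELETE the COMBINATION-SHAPED residual classes of the
Birch–Swinnerton-Dyer formula for ALL analytic-rank `≤ 1` elliptic curves over `ℚ` — "full BSD
formula for every rank `≤ 1` curve in class `C`" assembled STRICTLY from published theorems — so
that the rank-`≤ 1` remainder becomes exactly the CONSTRUCTION-SHAPED classes, which are TYPED
(missing-input `Prop`s), NOT attempted. This is not "finishing BSD". Team n1011 (N10/N11, the
additive block `X4 ∧ p = 3`): research route on the CONSTRUCTION-SHAPED class X4 / §I N11; TOOL
theorems only; nothing is booked; no mark / label / flag text moves; census −0.

## What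

K1 (`Rat.rubinEulerFactor_galoisRepTate`) gives Rubin's Euler factor of the Tate module at a good
place `v = q ≠ p`: `P(X) = P(Fr⁻¹ | T_pE*; X) = 1 − (a_q/q) X + (1/q) X²`.  THEOREM C of row T-DER
(n1011-p11, skel STATUS v8 (v8-2): Perrin-Riou AIF 1998 Prop. 3.1.6 / [Ru6] Thm. 4.5.4) needs the
value of this polynomial AT THE OPERATOR `F = ρ(Fr⁻¹)` on `T_pE` itself, factored through
`N_q = q − 1`:

* `Rat.smul_sq_sub_smul_add_one_galoisRepTate_inv_eq_zero` — Cayley–Hamilton read on `Fr⁻¹`: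
  `q·F² − a_q·F + 1 = 0` in `End(T_pE)` (from `χ_{ρ(Fr)} = X² − a_q X + q` and `ρ(Fr) F = 1`);
* `Rat.aeval_galoisRepTate_inv_rubinEulerFactor` — **`P(F) = (q − 1) · Z_q`** with the explicit
  `Z_q = q⁻¹ · (a_q·F − (q + 1)·F²)` (`q⁻¹` the inverse of the unit `q = χ_p(Fr)` of `ℤ_p`), i.e.
  Perrin-Riou's `P_q(Fr⁻¹) = N_q · Z(λ)`; equivalently `Z_q = q⁻¹ Fr⁻² (a_q Fr − q − 1)`;
* `Rat.aeval_galoisRepTate_inv_rubinEulerFactor_eq_nsmul` — the same with `N_q = q − 1 : ℕ` acting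
  by `nsmul` (the shape of the ascent lemma's `N • Z y`);
* `Rat.aeval_galoisRepTate_inv_rubinEulerFactor_apply` — the same pointwise with `(N_q : ℤ_p) •`,
  `N_q = q − 1 : ℕ` (the shape `hZ` of n1011-p11's assembly G2 / C0d);
* `Rat.commute_galoisRepTate_smul_sub_smul_sq` — `ρ(Fr)` commutes with `Z_q` (and with every
  `c · (a′·F − b·F²)`).

Theorems only; 0 defs, 0 named facts, 0 sorry.  Ref (context only): Rubin, *Euler Systems* (2000)
Ch. III §5; B. Perrin-Riou, Ann. Inst. Fourier 48 (1998), Prop. 3.1.6 (`P_ℓ(σ_ℓ⁻¹) = N_ℓ Z(λ)`).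
-/

noncomputable section

open Polynomial Field IsDedekindDomain
open scoped NumberField

namespace Summit.BirchSwinnertonDyer.Rank1Residual.GaloisImage.CyclotomicLevel

open Literature.NumberTheory.GaloisRepresentations Literature.NumberTheory.EllipticCurves

namespace Rat

variable (W : WeierstrassCurve ℚ) [W.IsElliptic] [W.IsGloballyMinimal] (p : ℕ) [Fact p.Prime]

/-- **Cayley–Hamilton on `Fr⁻¹`.**  At a place `v = q ≠ p` of good reduction with arithmetic
Frobenius `Fr`, the operator `F = ρ(Fr⁻¹)` on `T_pE` satisfies `q·F² − a_q·F + 1 = 0`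
(`ρ(Fr)² − a_q ρ(Fr) + q = 0` multiplied by `F²`).  Silverman, *AEC* V.2.3.1 / C.21.3 via the
tree's `charpoly_tateModule_eq`. [folklore] -/
theorem smul_sq_sub_smul_add_one_galoisRepTate_inv_eq_zero {v : HeightOneSpectrum (𝓞 ℚ)}
    (hne : ((Rat.HeightOneSpectrum.primesEquiv v : Nat.Primes) : ℕ) ≠ p)
    (hv : W.HasGoodReductionAt v) {Fr : absoluteGaloisGroup ℚ} (hFr : IsArithFrobAtPlace ℚ v Fr) :
    (((Rat.HeightOneSpectrum.primesEquiv v : Nat.Primes) : ℕ) : ℤ_[p]) • W.galoisRepTate p Fr⁻¹ ^ 2 -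
        (W.frobeniusTrace (Rat.HeightOneSpectrum.primesEquiv v) : ℤ_[p]) • W.galoisRepTate p Fr⁻¹ +
      1 = 0 := by
  haveI := W.module_free_tateModule_holds p
  haveI := W.module_finite_tateModule_holds p
  set q : ℕ := ((Rat.HeightOneSpectrum.primesEquiv v : Nat.Primes) : ℕ) with hqdef
  set G := W.galoisRepTate p Fr with hG
  set F := W.galoisRepTate p Fr⁻¹ with hF
  obtain ⟨𝔓, h𝔓, hσ⟩ := hFr
  have hp : (p : 𝓞 ℚ) ∉ v.asIdeal :=
    WeierstrassCurve.natCast_not_mem_asIdeal_of_primesEquiv_ne Fact.out hne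
  -- the characteristic polynomial of `Fr` on `T_p E`: `X² − a_q X + q`
  have hchar : G.charpoly =
      X ^ 2 - C (W.frobeniusTrace (Rat.HeightOneSpectrum.primesEquiv v) : ℤ_[p]) * X +
        C (q : ℤ_[p]) := by
    have hpℚ : (p : ℚ) ≠ 0 := Nat.cast_ne_zero.mpr (Fact.out : p.Prime).ne_zero
    rw [hG, WeierstrassCurve.charpoly_tateModule_eq hpℚ,
      W.trace_galoisRepTate_frobenius_eq_frobeniusTrace p hne hv h𝔓 hσ,
      W.det_galoisRepTate_frobenius_of_hasGoodReductionAt_holds p v hp hv h𝔓 hσ,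
      WeierstrassCurve.natCard_residueField_adicCompletionIntegers]
  -- Cayley–Hamilton: `G² − a G + q = 0`
  have hCH : G ^ 2 - (W.frobeniusTrace (Rat.HeightOneSpectrum.primesEquiv v) : ℤ_[p]) • G +
      (q : ℤ_[p]) • (1 : Module.End ℤ_[p] (W.tateModule p)) = 0 := by
    have h := LinearMap.aeval_self_charpoly G
    rw [hchar] at h
    simpa [sub_eq_add_neg, Algebra.smul_def, Algebra.algebraMap_eq_smul_one, smul_mul_assoc] using h
  -- `F G = G F = 1`
  have hFG : F * G = 1 := by rw [hF, hG, ← map_mul, inv_mul_cancel, map_one]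
  have hGF : G * F = 1 := by rw [hF, hG, ← map_mul, mul_inv_cancel, map_one]
  have hG2F2 : G ^ 2 * F ^ 2 = 1 := by
    rw [pow_two, pow_two, mul_assoc, ← mul_assoc G F F, hGF, one_mul, hGF]
  have hGF2 : G * F ^ 2 = F := by rw [pow_two, ← mul_assoc, hGF, one_mul]
  -- multiply Cayley–Hamilton by `F²` on the right
  have h := congrArg (· * F ^ 2) hCH
  simp only [sub_mul, add_mul, zero_mul, smul_mul_assoc, one_mul, hG2F2, hGF2] at h
  -- h : 1 - a • F + q • F^2 = 0
  rw [← h]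
  abel

/-- **`P(Fr⁻¹ | T_pE*; Fr⁻¹) = N_q · Z_q` as operators on `T_p E`** (Perrin-Riou's
`P_q(Fr⁻¹) = N_q Z(λ)`, `N_q = q − 1`): with `F = ρ(Fr⁻¹)` and the unit `u = χ_p(Fr) = q` of `ℤ_p`,
`aeval F (P(Fr⁻¹ | T*; X)) = (q − 1) · (u⁻¹ · (a_q·F − (q + 1)·F²))`
(`= (q−1) · q⁻¹ Fr⁻² (a_q Fr − q − 1)`).  From K1's `P = 1 − u⁻¹a_q X + u⁻¹ X²` and
`q F² − a_q F + 1 = 0`. [folklore] -/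
theorem aeval_galoisRepTate_inv_rubinEulerFactor {v : HeightOneSpectrum (𝓞 ℚ)}
    (hne : ((Rat.HeightOneSpectrum.primesEquiv v : Nat.Primes) : ℕ) ≠ p)
    (hv : W.HasGoodReductionAt v) {Fr : absoluteGaloisGroup ℚ} (hFr : IsArithFrobAtPlace ℚ v Fr) :
    haveI := W.module_free_tateModule_holds p
    haveI := W.module_finite_tateModule_holds p
    ∃ u : ℤ_[p]ˣ, (u : ℤ_[p]) = ((Rat.HeightOneSpectrum.primesEquiv v : Nat.Primes) : ℕ) ∧
      aeval (W.galoisRepTate p Fr⁻¹)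
          (rubinEulerFactor (W.galoisRepTate p) (cyclotomicCharacterToUnits ℚ p ℤ_[p]) Fr) =
        ((((Rat.HeightOneSpectrum.primesEquiv v : Nat.Primes) : ℕ) : ℤ_[p]) - 1) •
          ((↑u⁻¹ : ℤ_[p]) •
            ((W.frobeniusTrace (Rat.HeightOneSpectrum.primesEquiv v) : ℤ_[p]) • W.galoisRepTate p Fr⁻¹ -
              ((((Rat.HeightOneSpectrum.primesEquiv v : Nat.Primes) : ℕ) : ℤ_[p]) + 1) •
                W.galoisRepTate p Fr⁻¹ ^ 2)) := by
  haveI := W.module_free_tateModule_holds p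
  haveI := W.module_finite_tateModule_holds p
  obtain ⟨u, hu, hP⟩ := rubinEulerFactor_galoisRepTate W p hne hv hFr
  refine ⟨u, hu, ?_⟩
  have hrel := smul_sq_sub_smul_add_one_galoisRepTate_inv_eq_zero W p hne hv hFr
  set q : ℕ := ((Rat.HeightOneSpectrum.primesEquiv v : Nat.Primes) : ℕ) with hqdef
  set a : ℤ_[p] := (W.frobeniusTrace (Rat.HeightOneSpectrum.primesEquiv v) : ℤ_[p]) with hadef
  set F := W.galoisRepTate p Fr⁻¹ with hF
  have hu1 : ((u⁻¹ : ℤ_[p]ˣ) : ℤ_[p]) * (q : ℤ_[p]) = 1 := by rw [← hu, Units.inv_mul]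
  rw [hP]
  simp only [map_add, map_sub, map_mul, map_pow, aeval_one, aeval_C, aeval_X,
    Algebra.algebraMap_eq_smul_one, smul_mul_assoc, one_mul]
  -- replace `1` by `a • F − q • F²`
  have h1 : (1 : Module.End ℤ_[p] (W.tateModule p)) = a • F - (q : ℤ_[p]) • F ^ 2 := by
    rw [← sub_eq_zero, show (1 : Module.End ℤ_[p] (W.tateModule p)) - (a • F - (q : ℤ_[p]) • F ^ 2) =
      (q : ℤ_[p]) • F ^ 2 - a • F + 1 by abel]
    exact hrel
  rw [h1]
  match_scalars <;>
    first
    | linear_combination (-a) * hu1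
    | linear_combination (q : ℤ_[p]) * hu1

/-- The same with `N_q = q − 1` a NATURAL number acting by `nsmul` — the literal shape `N • Z y`
of the congruence ascent `Congruence.exists_sub_eq_sub_one_apply_of_ascent` (`htame`). [folklore] -/
theorem aeval_galoisRepTate_inv_rubinEulerFactor_eq_nsmul {v : HeightOneSpectrum (𝓞 ℚ)}
    (hne : ((Rat.HeightOneSpectrum.primesEquiv v : Nat.Primes) : ℕ) ≠ p)
    (hv : W.HasGoodReductionAt v) {Fr : absoluteGaloisGroup ℚ} (hFr : IsArithFrobAtPlace ℚ v Fr) :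
    haveI := W.module_free_tateModule_holds p
    haveI := W.module_finite_tateModule_holds p
    ∃ u : ℤ_[p]ˣ, (u : ℤ_[p]) = ((Rat.HeightOneSpectrum.primesEquiv v : Nat.Primes) : ℕ) ∧
      aeval (W.galoisRepTate p Fr⁻¹)
          (rubinEulerFactor (W.galoisRepTate p) (cyclotomicCharacterToUnits ℚ p ℤ_[p]) Fr) =
        (((Rat.HeightOneSpectrum.primesEquiv v : Nat.Primes) : ℕ) - 1) •
          ((↑u⁻¹ : ℤ_[p]) •
            ((W.frobeniusTrace (Rat.HeightOneSpectrum.primesEquiv v) : ℤ_[p]) • W.galoisRepTate p Fr⁻¹ -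
              ((((Rat.HeightOneSpectrum.primesEquiv v : Nat.Primes) : ℕ) : ℤ_[p]) + 1) •
                W.galoisRepTate p Fr⁻¹ ^ 2)) := by
  obtain ⟨u, hu, h⟩ := aeval_galoisRepTate_inv_rubinEulerFactor W p hne hv hFr
  refine ⟨u, hu, ?_⟩
  rw [h, ← Nat.cast_smul_eq_nsmul ℤ_[p],
    Nat.cast_sub (Rat.HeightOneSpectrum.primesEquiv v : Nat.Primes).2.one_lt.le, Nat.cast_one]

/-- The same POINTWISE with `N_q = q − 1 : ℕ` cast into `ℤ_p` — the shape
`hZ : ∀ t, aeval (ρ Fr⁻¹) P t = (N_q : ℤ_[p]) • Z t` consumed by n1011-p11's THEOREM C assembly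
(G2 / C0d). [folklore] -/
theorem aeval_galoisRepTate_inv_rubinEulerFactor_apply {v : HeightOneSpectrum (𝓞 ℚ)}
    (hne : ((Rat.HeightOneSpectrum.primesEquiv v : Nat.Primes) : ℕ) ≠ p)
    (hv : W.HasGoodReductionAt v) {Fr : absoluteGaloisGroup ℚ} (hFr : IsArithFrobAtPlace ℚ v Fr) :
    haveI := W.module_free_tateModule_holds p
    haveI := W.module_finite_tateModule_holds p
    ∃ u : ℤ_[p]ˣ, (u : ℤ_[p]) = ((Rat.HeightOneSpectrum.primesEquiv v : Nat.Primes) : ℕ) ∧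
      ∀ t : W.tateModule p,
        aeval (W.galoisRepTate p Fr⁻¹)
            (rubinEulerFactor (W.galoisRepTate p) (cyclotomicCharacterToUnits ℚ p ℤ_[p]) Fr) t =
          ((((Rat.HeightOneSpectrum.primesEquiv v : Nat.Primes) : ℕ) - 1 : ℕ) : ℤ_[p]) •
            (((↑u⁻¹ : ℤ_[p]) •
              ((W.frobeniusTrace (Rat.HeightOneSpectrum.primesEquiv v) : ℤ_[p]) • W.galoisRepTate p Fr⁻¹ -
                ((((Rat.HeightOneSpectrum.primesEquiv v : Nat.Primes) : ℕ) : ℤ_[p]) + 1) •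
                  W.galoisRepTate p Fr⁻¹ ^ 2)) t) := by
  obtain ⟨u, hu, h⟩ := aeval_galoisRepTate_inv_rubinEulerFactor W p hne hv hFr
  refine ⟨u, hu, fun t => ?_⟩
  rw [h, LinearMap.smul_apply,
    Nat.cast_sub (Rat.HeightOneSpectrum.primesEquiv v : Nat.Primes).2.one_lt.le, Nat.cast_one]

omit [W.IsElliptic] [W.IsGloballyMinimal] in
/-- `ρ(Fr)` commutes with every `c · (a′·F − b·F²)`, `F = ρ(Fr⁻¹)` — in particular with the operator
`Z_q` of `aeval_galoisRepTate_inv_rubinEulerFactor` (the `Commute Φ Z` input of the congruence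
ascent `Congruence.exists_sub_eq_sub_one_apply_of_ascent`); so does every power of `ρ(Fr)`
(`Commute.pow_left`). [folklore] -/
theorem commute_galoisRepTate_smul_sub_smul_sq (Fr : absoluteGaloisGroup ℚ) (c a' b : ℤ_[p]) :
    Commute (W.galoisRepTate p Fr)
      (c • (a' • W.galoisRepTate p Fr⁻¹ - b • W.galoisRepTate p Fr⁻¹ ^ 2)) := by
  have h : Commute (W.galoisRepTate p Fr) (W.galoisRepTate p Fr⁻¹) :=
    ((Commute.refl Fr).inv_right).map (W.galoisRepTate p)
  exact ((h.smul_right a').sub_right ((h.pow_right 2).smul_right b)).smul_right c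

end Rat

end Summit.BirchSwinnertonDyer.Rank1Residual.GaloisImage.CyclotomicLevel

end
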